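import Literature.Computability.Complexity.ExtMonotoneGates
import Literature.Computability.Complexity.CircuitComposition
import Mathlib.Data.List.GetD
import HarnessLib

/-!
# Extended monotone gates (gate-level predicate) and the monotonicity of extended monotone circuits

Companion to `Literature/Computability/Complexity/ExtMonotoneGates.lean`, which defines the three
wide monotone gate classes `IsConvGate` (SDP-feasibility, Oliveira–Pudlák 2019, Def. 3.1 in
feasibility form), `IsPermGate` (permutation-group membership, Furst–Hopcroft–Luks 1980),
`IsGRankGate` (generic-rank threshold, Edmonds 1967) and the *extended monotone basis*
`extGate s = {∧₂, ∨₂} ∪ CONV_s ∪ PERM_s ∪ GRANK_s : Set GateFn` of route PneNP/ConvexRankGates.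

* `ExtMonotoneGate s g` — the gate-level predicate "`g` is an extended monotone gate of size
  parameter `≤ s`", definitionally `g ∈ extGate s` (`extMonotoneGate_iff_mem`, `extGate_eq_setOf`),
  with the flat description `extMonotoneGate_iff` and dot-notation API: `.mono` (size parameter),
  `.monotone` (every extended monotone gate computes a monotone Boolean function), constructors
  from the three classes, `∧₂`, `∨₂`, and — for `1 ≤ s` — all threshold gates `Tₜᵏ`, `∧ₖ`, `∨ₖ`,
  `MAJₖ` (they are CONV gates of size one). Circuits consume the set (`Circuit.IsOver (extGate s)`,
  `Circuit.isOver_extGate_iff`); single-gate statements consume the predicate. The noun-style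
  name is the one filed by the definition request (cf. `Nat.Prime`).
* `GateList.monotone_wireOf_vals_of_forall_monotone`, `Circuit.monotone_eval_of_forall_monotone`,
  `Circuit.monotone_eval_of_isOver` — a straight-line program all of whose gates compute monotone
  Boolean functions carries a monotone Boolean function of the input on EVERY wire (inputs, gates,
  and out-of-range wires, which read the constant `false`); no well-formedness is needed. This is
  the general form of `Circuit.monotone_eval_of_isOver_monotoneBasis` (`NegationElimination.lean`,
  basis `{∧₂, ∨₂}` only): Jukna 2012, §9.6 (monotone real circuits, PDF p. 278: "at each
  intermediate gate any monotone function `f : {0,1}ⁿ → ℝ` may be computed") — by induction along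
  the program (a monotone gate applied to a tuple of monotone wires is monotone).
* `Circuit.monotone_eval_of_isOver_extGate`, `Circuit.Computes.monotone_of_isOver_extGate`,
  `Circuit.not_computes_of_not_monotone` — **every circuit over the extended monotone basis `B_s`
  computes a monotone Boolean function**, whatever `s` and whatever its size: the model of route
  PneNP/ConvexRankGates is monotone *by syntax* (`extGate_monotone`), so the hypothesis
  `Monotone f` of its crux `Capture` is necessary, and e.g. no `B_s`-circuit computes a negated
  variable (`Circuit.not_computes_bnot_of_isOver_extGate`).

NOT here: anything quantitative (sizes, lower bounds), and the route's items.
-/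

namespace Literature.Computability.Complexity

/-! ### The gate-level predicate -/

/-- **Extended monotone gate** of size parameter `≤ s`: the predicate form of membership in the
extended monotone basis `extGate s = {∧₂, ∨₂} ∪ CONV_s ∪ PERM_s ∪ GRANK_s` of route
PneNP/ConvexRankGates — `g` is `∧₂`, `∨₂`, a monotone SDP-feasibility gate with
`#constraints + dim ≤ s` (Oliveira–Pudlák 2019, Def. 3.1, feasibility form: `IsConvGate`), a
permutation-group membership gate on `≤ s` points (Furst–Hopcroft–Luks 1980: `IsPermGate`), or a
generic-rank threshold gate of dimension `≤ s` (Edmonds 1967: `IsGRankGate`). The basis is the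
route's construct; its constituents are the cited published gate types. [folklore] -/
def ExtMonotoneGate (s : ℕ) (g : GateFn) : Prop := g ∈ extGate s

variable {s t : ℕ} {g : GateFn}

/-- `ExtMonotoneGate s g` is membership in `extGate s` (definitional). [folklore] -/
theorem extMonotoneGate_iff_mem : ExtMonotoneGate s g ↔ g ∈ extGate s := Iff.rfl

/-- The extended basis is the set of extended monotone gates (definitional). [folklore] -/
theorem extGate_eq_setOf (s : ℕ) : extGate s = {g | ExtMonotoneGate s g} := rfl

/-- Flat description: an extended monotone gate is `∧₂`, `∨₂`, a CONV, a PERM or a GRANK gate of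
size parameter `≤ s`. [folklore] -/
theorem extMonotoneGate_iff : ExtMonotoneGate s g ↔
    g = GateFn.and 2 ∨ g = GateFn.or 2 ∨ IsConvGate s g ∨ IsPermGate s g ∨ IsGRankGate s g :=
  mem_extGate_iff

/-- `∧₂` is an extended monotone gate (for every size parameter). [folklore] -/
theorem ExtMonotoneGate.and_two (s : ℕ) : ExtMonotoneGate s (GateFn.and 2) := and_mem_extGate s

/-- `∨₂` is an extended monotone gate (for every size parameter). [folklore] -/
theorem ExtMonotoneGate.or_two (s : ℕ) : ExtMonotoneGate s (GateFn.or 2) := or_mem_extGate s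

/-- CONV gates are extended monotone gates. [folklore] -/
theorem IsConvGate.extMonotoneGate (h : IsConvGate s g) : ExtMonotoneGate s g := h.mem_extGate

/-- PERM gates are extended monotone gates. [folklore] -/
theorem IsPermGate.extMonotoneGate (h : IsPermGate s g) : ExtMonotoneGate s g := h.mem_extGate

/-- GRANK gates are extended monotone gates. [folklore] -/
theorem IsGRankGate.extMonotoneGate (h : IsGRankGate s g) : ExtMonotoneGate s g := h.mem_extGate

/-- Threshold gates `Tₜᵏ` of any arity are extended monotone gates as soon as `1 ≤ s` (they are
CONV gates of size one, `thr_isConvGate`). [folklore] -/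
theorem ExtMonotoneGate.thr (k th : ℕ) (hs : 1 ≤ s) : ExtMonotoneGate s (GateFn.thr k th) :=
  ((thr_isConvGate k th).mono hs).extMonotoneGate

/-- `∧ₖ` of any arity is an extended monotone gate for `1 ≤ s`. [folklore] -/
theorem ExtMonotoneGate.and (k : ℕ) (hs : 1 ≤ s) : ExtMonotoneGate s (GateFn.and k) :=
  ((and_isConvGate k).mono hs).extMonotoneGate

/-- `∨ₖ` of any arity is an extended monotone gate for `1 ≤ s`. [folklore] -/
theorem ExtMonotoneGate.or (k : ℕ) (hs : 1 ≤ s) : ExtMonotoneGate s (GateFn.or k) :=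
  ((or_isConvGate k).mono hs).extMonotoneGate

/-- `MAJₖ` of any arity is an extended monotone gate for `1 ≤ s`. [folklore] -/
theorem ExtMonotoneGate.maj (k : ℕ) (hs : 1 ≤ s) : ExtMonotoneGate s (GateFn.maj k) :=
  ((maj_isConvGate k).mono hs).extMonotoneGate

/-- Monotonicity in the size parameter: `B_s ⊆ B_t` for `s ≤ t`. [folklore] -/
theorem ExtMonotoneGate.mono (h : ExtMonotoneGate s g) (hst : s ≤ t) : ExtMonotoneGate t g :=
  extGate_mono hst h

/-- **Every extended monotone gate computes a monotone Boolean function** (`B ≥ 0` for CONV,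
monotonicity of `Subgroup.closure` for PERM, specialisation `Xᵢ := 0` for GRANK; see
`extGate_monotone`). [folklore] -/
theorem ExtMonotoneGate.monotone (h : ExtMonotoneGate s g) : Monotone g.2 := extGate_monotone h

/-- A circuit is over the extended basis iff each of its gates is an extended monotone gate
(definitional). [folklore] -/
theorem Circuit.isOver_extGate_iff {ι : Type*} (C : Circuit ι) :
    C.IsOver (extGate s) ↔ ∀ g ∈ C.gates, ExtMonotoneGate s g.fn := Iff.rfl

/-- A `B_s`-circuit is a `B_t`-circuit for `s ≤ t` (used to absorb polynomial reparametrisations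
of the size parameter). [folklore] -/
theorem Circuit.IsOver.extGate_of_le {ι : Type*} {C : Circuit ι} (h : C.IsOver (extGate s))
    (hst : s ≤ t) : C.IsOver (extGate t) :=
  h.mono (extGate_mono hst)

/-! ### Programs over monotone gates carry monotone functions on every wire -/

namespace GateList

variable {ι : Type*}

/-- If every gate of a straight-line program computes a monotone Boolean function, then every
wire — an input, a gate, or an out-of-range reference (constant `false`) — carries a monotone
function of the input assignment (Jukna 2012, §9.6, PDF p. 278: "at each intermediate gate any
monotone function … may be computed"; induction along the program: the new gate applies a
monotone map to a tuple of monotone wires). No well-formedness hypothesis. [folklore] -/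
theorem monotone_wireOf_vals_of_forall_monotone (gs : List (Gate ι))
    (hgs : ∀ g ∈ gs, Monotone g.op) (w : ι ⊕ ℕ) :
    Monotone fun x => wireOf x (vals gs x) w := by
  induction gs using List.reverseRecOn generalizing w with
  | nil =>
    rcases w with i | m
    · exact fun x y hxy => hxy i
    · exact fun x y _ => le_rfl
  | append_singleton gs g ih =>
    have ih' := ih fun g' hg' => hgs g' (List.mem_append_left _ hg')
    have hg : Monotone g.op := hgs g (List.mem_append_right _ (List.mem_singleton_self g))
    rcases w with i | m
    · exact fun x y hxy => hxy i
    · intro x y hxy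
      show (vals (gs ++ [g]) x).getD m false ≤ (vals (gs ++ [g]) y).getD m false
      rcases lt_trichotomy m gs.length with hm | rfl | hm
      · -- an old gate
        have key : ∀ z, (vals (gs ++ [g]) z).getD m false = (vals gs z).getD m false :=
          fun z => by
            rw [vals_append_singleton,
              List.getD_append _ _ _ _ (hm.trans_eq (length_vals gs z).symm)]
        rw [key, key]
        exact ih' (.inr m) hxy
      · -- the new gate
        have key : ∀ z, (vals (gs ++ [g]) z).getD gs.length false =
            g.op (fun a => wireOf z (vals gs z) (g.args a)) := fun z => by
          rw [vals_append_singleton, List.getD_append_right _ _ _ _ (length_vals gs z).le,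
            length_vals, Nat.sub_self, List.getD_cons_zero]
        rw [key, key]
        exact hg fun a => ih' (g.args a) hxy
      · -- out of range
        have key : ∀ z, (vals (gs ++ [g]) z).getD m false = false := fun z =>
          List.getD_eq_default _ _
            (by rw [length_vals, List.length_append, List.length_singleton]; omega)
        rw [key, key]

end GateList

/-- **A circuit all of whose gates compute monotone Boolean functions computes a monotone Boolean
function** (Jukna 2012, §9.6; for the basis `{∧₂, ∨₂}` this is
`Circuit.monotone_eval_of_isOver_monotoneBasis`). [folklore] -/
theorem Circuit.monotone_eval_of_forall_monotone {ι : Type*} (C : Circuit ι)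
    (hC : ∀ g ∈ C.gates, Monotone g.op) : Monotone C.eval := by
  obtain ⟨gs, o, hwf, ho⟩ := C
  have h := GateList.monotone_wireOf_vals_of_forall_monotone gs hC o
  cases o <;> exact h

/-- A circuit over a basis of monotone gate functions computes a monotone Boolean function
(Jukna 2012, §9.6). [folklore] -/
theorem Circuit.monotone_eval_of_isOver {ι : Type*} {B : Set GateFn}
    (hB : ∀ g ∈ B, Monotone g.2) (C : Circuit ι) (hC : C.IsOver B) : Monotone C.eval :=
  C.monotone_eval_of_forall_monotone fun g hg => hB g.fn (hC g hg)

/-! ### Extended monotone circuits compute monotone functions -/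

/-- **Every circuit over the extended monotone basis `B_s` computes a monotone Boolean
function**, whatever `s` and whatever its size (`extGate_monotone` gate by gate, then
`Circuit.monotone_eval_of_isOver`). [folklore] -/
theorem Circuit.monotone_eval_of_isOver_extGate {ι : Type*} (C : Circuit ι)
    (hC : C.IsOver (extGate s)) : Monotone C.eval :=
  Circuit.monotone_eval_of_isOver (fun _ hg => extGate_monotone hg) C hC

/-- Hence a Boolean function computed by a `B_s`-circuit is monotone: the hypothesis
`Monotone f` in the crux `Capture` of route PneNP/ConvexRankGates is necessary. [folklore] -/
theorem Circuit.Computes.monotone_of_isOver_extGate {ι : Type*} {C : Circuit ι}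
    {f : (ι → Bool) → Bool} (hf : C.Computes f) (hC : C.IsOver (extGate s)) : Monotone f := by
  intro x y hxy
  rw [← hf x, ← hf y]
  exact C.monotone_eval_of_isOver_extGate hC hxy

/-- Contrapositive: no circuit over `B_s` — of any size — computes a non-monotone Boolean
function. [folklore] -/
theorem Circuit.not_computes_of_not_monotone {ι : Type*} (C : Circuit ι)
    (hC : C.IsOver (extGate s)) {f : (ι → Bool) → Bool} (hf : ¬ Monotone f) :
    ¬ C.Computes f :=
  fun h => hf (h.monotone_of_isOver_extGate hC)

/-- The negation of an input variable is not monotone. [folklore] -/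
theorem not_monotone_bnot_apply {ι : Type*} (i : ι) : ¬ Monotone fun x : ι → Bool => !(x i) := by
  intro h
  have h1 : (fun _ : ι => false) ≤ (fun _ : ι => true) := fun _ => Bool.false_le _
  have h2 : (true : Bool) ≤ false := h h1
  exact absurd h2 (by decide)

/-- In particular no circuit over the extended monotone basis computes a negated variable
`x ↦ ¬ xᵢ`: the extended model has no hidden negations. [folklore] -/
theorem Circuit.not_computes_bnot_of_isOver_extGate {ι : Type*} (C : Circuit ι)
    (hC : C.IsOver (extGate s)) (i : ι) : ¬ C.Computes fun x => !(x i) :=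
  C.not_computes_of_not_monotone hC (not_monotone_bnot_apply i)

end Literature.Computability.Complexity
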